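import Mathlib.Analysis.InnerProductSpace.Basic
import Mathlib.Tactic.LinearCombination

/-!
# Stability of the tangent-frame sum of `Φ(‖Y‖, t)` near the flat model: the scalar estimate

Topic `Geometry/Riemannian` (fact seat
`provefact-Literature.Geometry.Riemannian.LawsonMichelsohn1984_surrounding`).  Everything here
is **proved**; no definitions.

In the junction of Lawson–Michelsohn's surrounding construction (§3) the new hypersurface near an
attaching sphere is `{Φ(‖Y‖, t) = 0}` for a planar profile `Φ` and *Fermi data* `(Y, t)`:
`t` a normalised defining function of the mean-convex boundary `Σ` (`|∇t| = 1` on `Σ`) and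
`Y : E → F` normal coordinates to the (orthogonalised) descending disc (`DY` a co-isometry on the
disc, `DY ∇t = 0` on the attaching sphere).  Off the sphere these normalisations hold only up to
a defect `δ = O(r + |t|)`.  By `MeanConvexFermiHessian.fderiv_fderiv_fermiFun_apply` and the
frame-sum identity of `MeanConvexFrameSum`, the tangent-frame sum of `D²[Φ ∘ (‖Y‖, t)]` at a point
is — apart from the second-derivative terms `Φ_r ⟨ŷ, D²Y(v, v)⟩ + Φ_t D²t(v, v)` — an explicit
rational expression `tr M - M(g, g)/‖g‖²` in `D²Φ`, `Φ_r / r` and the seven scalars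
`n₁ = ‖a‖²`, `n₂ = ‖b‖²`, `n₃ = ⟨a, b⟩`, `n₄ = ∑ⱼ ‖L bⱼ‖²`, `n₅ = ‖L a‖²`, `n₆ = ‖L b‖²`,
`n₇ = ⟨L a, L b⟩` (`L = DY`, `a = L† ŷ`, `b = ∇t`), whose flat values are `(1, 1, 0, k, 1, 0, 0)`
and whose flat expression is the value `Q_k(Φ)` of `MeanConvexFlatFrameSum.frameSum_biradial`.
This file proves the scalar stability estimate:

* `abs_scalarFrameSum_sub_flat_le` — if the seven scalars are within `δ ≤ 1/4` of their flat
  values then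
  `|tr M - M(g,g)/‖g‖² - Q_k(Φ)| ≤ 20 δ (|Φ_rr| + |Φ_rt + Φ_tr| + |Φ_tt|) + 20 δ |Φ_r| / r`
  — a *relative* error on the two scales `‖D²Φ‖` and `|Φ_r|/r` of the flat frame sum, uniformly
  in the direction of `∇Φ ≠ 0` (elementary algebra of the explicit rational expression: the
  denominator moves by `≤ 2δ‖∇Φ‖²`, the numerator by `≤ 6δ‖∇Φ‖²‖D²Φ‖ + 7δ‖∇Φ‖²|Φ_r|/r`).

## References

* H. B. Lawson, Jr., M.-L. Michelsohn, *Embedding and surrounding with positive mean curvature*,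
  Invent. Math. 77 (1984), §3. [LawsonMichelsohn1984]
-/

noncomputable section

open Set Function

namespace Literature.Geometry.Riemannian

/-! ### Stability of the scalar frame sum near the flat data -/

section Scalar

/-- `2|xy| ≤ x² + y²`. [folklore] -/
theorem two_mul_abs_mul_le (x y : ℝ) : 2 * |x * y| ≤ x ^ 2 + y ^ 2 := by
  rw [abs_mul]
  nlinarith [sq_nonneg (|x| - |y|), sq_abs x, sq_abs y, abs_nonneg x, abs_nonneg y]

/-- **Stability of the scalar frame sum near the flat data.**  With the seven scalars
`n₁ = ‖a‖²`, `n₂ = ‖b‖²`, `n₃ = ⟨a, b⟩`, `n₄ = ∑ⱼ ‖L bⱼ‖²`, `n₅ = ‖L a‖²`, `n₆ = ‖L b‖²`,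
`n₇ = ⟨L a, L b⟩` within `δ ≤ 1/4` of `(1, 1, 0, k, 1, 0, 0)`, the scalar frame sum
`tr M - M(g, g)/‖g‖²` of `frameSum_fermiFun` differs from the flat value
`(A Φ_t² - B Φ_r Φ_t + C Φ_r²)/(Φ_r² + Φ_t²) + (k - 1) Φ_r / r` (`A = Φ_rr`, `B = Φ_rt + Φ_tr`,
`C = Φ_tt`) by at most `20 δ (|A| + |B| + |C|) + 20 δ |Φ_r| / r`. [folklore] -/
theorem abs_scalarFrameSum_sub_flat_le {A B C φr φt r k δ n₁ n₂ n₃ n₄ n₅ n₆ n₇ : ℝ}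
    (hr : 0 < r) (hδ0 : 0 ≤ δ) (hδ : δ ≤ 1 / 4) (hφ : φr ≠ 0 ∨ φt ≠ 0)
    (h1 : |n₁ - 1| ≤ δ) (h2 : |n₂ - 1| ≤ δ) (h3 : |n₃| ≤ δ) (h4 : |n₄ - k| ≤ δ)
    (h5 : |n₅ - 1| ≤ δ) (h6 : |n₆| ≤ δ) (h7 : |n₇| ≤ δ) :
    |(A * n₁ + B * n₃ + C * n₂ + φr / r * (n₄ - n₁) -
        (A * (φr * n₁ + φt * n₃) ^ 2 + B * (φr * n₁ + φt * n₃) * (φr * n₃ + φt * n₂) +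
            C * (φr * n₃ + φt * n₂) ^ 2 +
          φr / r * ((φr ^ 2 * n₅ + 2 * φr * φt * n₇ + φt ^ 2 * n₆) - (φr * n₁ + φt * n₃) ^ 2)) /
          (φr ^ 2 * n₁ + 2 * φr * φt * n₃ + φt ^ 2 * n₂)) -
      ((A * φt ^ 2 - B * φr * φt + C * φr ^ 2) / (φr ^ 2 + φt ^ 2) + (k - 1) * φr / r)| ≤
      20 * δ * (|A| + |B| + |C|) + 20 * δ * |φr| / r := by
  -- flat quantities
  set D₀ : ℝ := φr ^ 2 + φt ^ 2 with hD₀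
  have hD₀pos : 0 < D₀ := by
    rcases hφ with h | h
    · have := sq_pos_of_ne_zero h; rw [hD₀]; linarith only [this, sq_nonneg φt]
    · have := sq_pos_of_ne_zero h; rw [hD₀]; linarith only [this, sq_nonneg φr]
  set h : ℝ := |A| + |B| + |C| with hh
  have hhnn : 0 ≤ h := by rw [hh]; positivity
  set s : ℝ := |φr| + |φt| with hs
  have hsnn : 0 ≤ s := by rw [hs]; positivity
  have hφφ : |φr * φt| ≤ D₀ / 2 := by
    have := two_mul_abs_mul_le φr φt; rw [hD₀]; linarith only [this]
  have hs2 : s ^ 2 ≤ 2 * D₀ := by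
    rw [hs, hD₀]
    have := two_mul_abs_mul_le φr φt
    rw [abs_mul] at this
    nlinarith only [this, sq_abs φr, sq_abs φt]
  have hφrs : |φr| ≤ s := by rw [hs]; linarith only [abs_nonneg φt]
  have hφts : |φt| ≤ s := by rw [hs]; linarith only [abs_nonneg φr]
  have hδ1 : δ ≤ 1 := by linarith only [hδ]
  -- perturbed quantities
  set α : ℝ := φr * n₁ + φt * n₃ with hα
  set β : ℝ := φr * n₃ + φt * n₂ with hβ
  set D : ℝ := φr ^ 2 * n₁ + 2 * φr * φt * n₃ + φt ^ 2 * n₂ with hD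
  set Lg : ℝ := φr ^ 2 * n₅ + 2 * φr * φt * n₇ + φt ^ 2 * n₆ with hLg
  set N : ℝ := A * α ^ 2 + B * α * β + C * β ^ 2 + φr / r * (Lg - α ^ 2) with hN
  set N₀ : ℝ := A * φr ^ 2 + B * φr * φt + C * φt ^ 2 with hN₀
  set trM : ℝ := A * n₁ + B * n₃ + C * n₂ + φr / r * (n₄ - n₁) with htrM
  set trM₀ : ℝ := A + C + φr / r * (k - 1) with htrM₀
  -- the flat value as `trM₀ - N₀/D₀`
  have hD₀ne : D₀ ≠ 0 := hD₀pos.ne'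
  have hflat : (A * φt ^ 2 - B * φr * φt + C * φr ^ 2) / (φr ^ 2 + φt ^ 2) + (k - 1) * φr / r =
      trM₀ - N₀ / D₀ := by
    have e1 : (A * φt ^ 2 - B * φr * φt + C * φr ^ 2) / D₀ = A + C - N₀ / D₀ := by
      rw [eq_sub_iff_add_eq, ← add_div, div_eq_iff hD₀ne, hN₀, hD₀]
      ring
    rw [← hD₀, e1, htrM₀]
    ring
  rw [hflat]
  have hsplit : trM - N / D - (trM₀ - N₀ / D₀) = (trM - trM₀) - (N / D - N₀ / D₀) := by ring
  rw [hsplit]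
  clear_value α β D Lg N N₀ trM trM₀ s h D₀
  -- (1) the trace
  have htr : |trM - trM₀| ≤ δ * h + 2 * δ * |φr| / r := by
    have e : trM - trM₀ = A * (n₁ - 1) + B * n₃ + C * (n₂ - 1) + φr / r * ((n₄ - k) - (n₁ - 1)) := by
      rw [htrM, htrM₀]; ring
    rw [e]
    have t1 : |A * (n₁ - 1)| ≤ |A| * δ := by rw [abs_mul]; exact mul_le_mul_of_nonneg_left h1 (abs_nonneg _)
    have t2 : |B * n₃| ≤ |B| * δ := by rw [abs_mul]; exact mul_le_mul_of_nonneg_left h3 (abs_nonneg _)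
    have t3 : |C * (n₂ - 1)| ≤ |C| * δ := by rw [abs_mul]; exact mul_le_mul_of_nonneg_left h2 (abs_nonneg _)
    have t4 : |φr / r * ((n₄ - k) - (n₁ - 1))| ≤ |φr| / r * (2 * δ) := by
      rw [abs_mul, abs_div, abs_of_pos hr]
      refine mul_le_mul_of_nonneg_left ?_ (by positivity)
      calc |(n₄ - k) - (n₁ - 1)| ≤ |n₄ - k| + |n₁ - 1| := abs_sub _ _
        _ ≤ δ + δ := add_le_add h4 h1
        _ = 2 * δ := by ring
    calc |A * (n₁ - 1) + B * n₃ + C * (n₂ - 1) + φr / r * ((n₄ - k) - (n₁ - 1))|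
        ≤ |A * (n₁ - 1)| + |B * n₃| + |C * (n₂ - 1)| + |φr / r * ((n₄ - k) - (n₁ - 1))| := by
          refine (abs_add_le _ _).trans (add_le_add ((abs_add_le _ _).trans (add_le_add (abs_add_le _ _) le_rfl)) le_rfl)
      _ ≤ |A| * δ + |B| * δ + |C| * δ + |φr| / r * (2 * δ) := by linarith only [t1, t2, t3, t4]
      _ = δ * h + 2 * δ * |φr| / r := by rw [hh]; ring
  -- (2) the denominator
  have hDD : |D - D₀| ≤ 2 * δ * D₀ := by
    have e : D - D₀ = φr ^ 2 * (n₁ - 1) + 2 * (φr * φt) * n₃ + φt ^ 2 * (n₂ - 1) := by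
      rw [hD, hD₀]; ring
    rw [e]
    have t1 : |φr ^ 2 * (n₁ - 1)| ≤ φr ^ 2 * δ := by
      rw [abs_mul, abs_of_nonneg (sq_nonneg _)]; exact mul_le_mul_of_nonneg_left h1 (sq_nonneg _)
    have t2 : |2 * (φr * φt) * n₃| ≤ 2 * |φr * φt| * δ := by
      rw [abs_mul, abs_mul, abs_of_pos (by norm_num : (0 : ℝ) < 2)]
      exact mul_le_mul_of_nonneg_left h3 (by positivity)
    have t3 : |φt ^ 2 * (n₂ - 1)| ≤ φt ^ 2 * δ := by
      rw [abs_mul, abs_of_nonneg (sq_nonneg _)]; exact mul_le_mul_of_nonneg_left h2 (sq_nonneg _)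
    calc |φr ^ 2 * (n₁ - 1) + 2 * (φr * φt) * n₃ + φt ^ 2 * (n₂ - 1)|
        ≤ |φr ^ 2 * (n₁ - 1)| + |2 * (φr * φt) * n₃| + |φt ^ 2 * (n₂ - 1)| :=
          (abs_add_le _ _).trans (add_le_add (abs_add_le _ _) le_rfl)
      _ ≤ φr ^ 2 * δ + 2 * |φr * φt| * δ + φt ^ 2 * δ := by linarith only [t1, t2, t3]
      _ ≤ 2 * δ * D₀ := by
          have e2 : 2 * |φr * φt| * δ ≤ D₀ * δ :=
            mul_le_mul_of_nonneg_right (by linarith [hφφ]) hδ0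
          have e3 : φr ^ 2 * δ + φt ^ 2 * δ = D₀ * δ := by rw [hD₀]; ring
          linarith only [e2, e3]
  have hDge : D₀ / 2 ≤ D := by
    have h' := (abs_sub_le_iff.1 hDD).2
    have h'' : δ * D₀ ≤ D₀ / 4 := by nlinarith only [hδ, hD₀pos, hδ0]
    linarith only [h', h'']
  have hDpos : 0 < D := by linarith only [hDge, hD₀pos]
  have hDne : D ≠ 0 := hDpos.ne'
  -- (3) the flat numerator
  have hN₀le : |N₀| ≤ h * D₀ := by
    rw [hN₀]
    have t1 : |A * φr ^ 2| ≤ |A| * D₀ := by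
      rw [abs_mul, abs_of_nonneg (sq_nonneg φr)]
      exact mul_le_mul_of_nonneg_left (by rw [hD₀]; linarith only [sq_nonneg φt]) (abs_nonneg _)
    have t2 : |B * φr * φt| ≤ |B| * D₀ := by
      rw [mul_assoc, abs_mul]
      exact mul_le_mul_of_nonneg_left (by linarith only [hφφ, hD₀pos]) (abs_nonneg _)
    have t3 : |C * φt ^ 2| ≤ |C| * D₀ := by
      rw [abs_mul, abs_of_nonneg (sq_nonneg φt)]
      exact mul_le_mul_of_nonneg_left (by rw [hD₀]; linarith only [sq_nonneg φr]) (abs_nonneg _)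
    calc |A * φr ^ 2 + B * φr * φt + C * φt ^ 2|
        ≤ |A * φr ^ 2| + |B * φr * φt| + |C * φt ^ 2| :=
          (abs_add_le _ _).trans (add_le_add (abs_add_le _ _) le_rfl)
      _ ≤ |A| * D₀ + |B| * D₀ + |C| * D₀ := by linarith only [t1, t2, t3]
      _ = h * D₀ := by rw [hh]; ring
  -- (4) `α`, `β` near `(φr, φt)`
  have hα1 : |α - φr| ≤ δ * s := by
    have e : α - φr = φr * (n₁ - 1) + φt * n₃ := by rw [hα]; ring
    rw [e]
    calc |φr * (n₁ - 1) + φt * n₃| ≤ |φr * (n₁ - 1)| + |φt * n₃| := abs_add_le _ _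
      _ ≤ |φr| * δ + |φt| * δ := by
          rw [abs_mul, abs_mul]
          exact add_le_add (mul_le_mul_of_nonneg_left h1 (abs_nonneg _))
            (mul_le_mul_of_nonneg_left h3 (abs_nonneg _))
      _ = δ * s := by rw [hs]; ring
  have hβ1 : |β - φt| ≤ δ * s := by
    have e : β - φt = φr * n₃ + φt * (n₂ - 1) := by rw [hβ]; ring
    rw [e]
    calc |φr * n₃ + φt * (n₂ - 1)| ≤ |φr * n₃| + |φt * (n₂ - 1)| := abs_add_le _ _
      _ ≤ |φr| * δ + |φt| * δ := by
          rw [abs_mul, abs_mul]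
          exact add_le_add (mul_le_mul_of_nonneg_left h3 (abs_nonneg _))
            (mul_le_mul_of_nonneg_left h2 (abs_nonneg _))
      _ = δ * s := by rw [hs]; ring
  have hδs : δ * s ≤ s := by nlinarith only [hδ1, hsnn, hδ0]
  have hαs : |α| ≤ 2 * s := by
    have := abs_sub_abs_le_abs_sub α φr
    linarith only [this, hα1, hδs, hφrs]
  have hβs : |β| ≤ 2 * s := by
    have := abs_sub_abs_le_abs_sub β φt
    linarith only [this, hβ1, hδs, hφts]
  -- the quadratic quantities: each differs from its flat value by `≤ 3 δ s²`
  have hq1 : |α ^ 2 - φr ^ 2| ≤ 3 * δ * s ^ 2 := by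
    have e : α ^ 2 - φr ^ 2 = (α - φr) * (α + φr) := by ring
    rw [e, abs_mul]
    have : |α + φr| ≤ 3 * s := by
      calc |α + φr| ≤ |α| + |φr| := abs_add_le _ _
        _ ≤ 2 * s + s := add_le_add hαs hφrs
        _ = 3 * s := by ring
    calc |α - φr| * |α + φr| ≤ (δ * s) * (3 * s) :=
          mul_le_mul hα1 this (abs_nonneg _) (by positivity)
      _ = 3 * δ * s ^ 2 := by ring
  have hq2 : |α * β - φr * φt| ≤ 3 * δ * s ^ 2 := by
    have e : α * β - φr * φt = (α - φr) * β + φr * (β - φt) := by ring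
    rw [e]
    calc |(α - φr) * β + φr * (β - φt)| ≤ |(α - φr) * β| + |φr * (β - φt)| := abs_add_le _ _
      _ = |α - φr| * |β| + |φr| * |β - φt| := by rw [abs_mul, abs_mul]
      _ ≤ (δ * s) * (2 * s) + s * (δ * s) :=
          add_le_add (mul_le_mul hα1 hβs (abs_nonneg _) (by positivity))
            (mul_le_mul hφrs hβ1 (abs_nonneg _) hsnn)
      _ = 3 * δ * s ^ 2 := by ring
  have hq3 : |β ^ 2 - φt ^ 2| ≤ 3 * δ * s ^ 2 := by
    have e : β ^ 2 - φt ^ 2 = (β - φt) * (β + φt) := by ring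
    rw [e, abs_mul]
    have : |β + φt| ≤ 3 * s := by
      calc |β + φt| ≤ |β| + |φt| := abs_add_le _ _
        _ ≤ 2 * s + s := add_le_add hβs hφts
        _ = 3 * s := by ring
    calc |β - φt| * |β + φt| ≤ (δ * s) * (3 * s) :=
          mul_le_mul hβ1 this (abs_nonneg _) (by positivity)
      _ = 3 * δ * s ^ 2 := by ring
  -- (5) the `H`-part of `N - N₀`
  have hHpart : |A * (α ^ 2 - φr ^ 2) + B * (α * β - φr * φt) + C * (β ^ 2 - φt ^ 2)| ≤
      6 * δ * D₀ * h := by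
    have t1 : |A * (α ^ 2 - φr ^ 2)| ≤ |A| * (3 * δ * s ^ 2) := by
      rw [abs_mul]; exact mul_le_mul_of_nonneg_left hq1 (abs_nonneg _)
    have t2 : |B * (α * β - φr * φt)| ≤ |B| * (3 * δ * s ^ 2) := by
      rw [abs_mul]; exact mul_le_mul_of_nonneg_left hq2 (abs_nonneg _)
    have t3 : |C * (β ^ 2 - φt ^ 2)| ≤ |C| * (3 * δ * s ^ 2) := by
      rw [abs_mul]; exact mul_le_mul_of_nonneg_left hq3 (abs_nonneg _)
    calc |A * (α ^ 2 - φr ^ 2) + B * (α * β - φr * φt) + C * (β ^ 2 - φt ^ 2)|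
        ≤ |A * (α ^ 2 - φr ^ 2)| + |B * (α * β - φr * φt)| + |C * (β ^ 2 - φt ^ 2)| :=
          (abs_add_le _ _).trans (add_le_add (abs_add_le _ _) le_rfl)
      _ ≤ (|A| + |B| + |C|) * (3 * δ * s ^ 2) := by linarith only [t1, t2, t3]
      _ ≤ 6 * δ * D₀ * h := by
          rw [← hh]
          have h3 : 3 * δ * s ^ 2 ≤ 3 * δ * (2 * D₀) :=
            mul_le_mul_of_nonneg_left hs2 (by positivity)
          have : h * (3 * δ * s ^ 2) ≤ h * (3 * δ * (2 * D₀)) :=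
            mul_le_mul_of_nonneg_left h3 hhnn
          linarith only [this]
  -- (6) the `L`-part of `N - N₀`
  have hLpart : |Lg - α ^ 2| ≤ 7 * δ * D₀ := by
    have e : Lg - α ^ 2 = φr ^ 2 * (n₅ - n₁ ^ 2) + 2 * (φr * φt) * (n₇ - n₁ * n₃) +
        φt ^ 2 * (n₆ - n₃ ^ 2) := by rw [hLg, hα]; ring
    rw [e]
    have hn1 : |n₁| ≤ 1 + δ := by
      have := abs_sub_abs_le_abs_sub n₁ 1; rw [abs_one] at this; linarith only [this, h1]
    have b1 : |n₅ - n₁ ^ 2| ≤ 4 * δ := by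
      have e1 : n₅ - n₁ ^ 2 = (n₅ - 1) - (n₁ - 1) * (n₁ + 1) := by ring
      rw [e1]
      calc |(n₅ - 1) - (n₁ - 1) * (n₁ + 1)| ≤ |n₅ - 1| + |(n₁ - 1) * (n₁ + 1)| := abs_sub _ _
        _ = |n₅ - 1| + |n₁ - 1| * |n₁ + 1| := by rw [abs_mul]
        _ ≤ δ + δ * (2 + δ) := by
            refine add_le_add h5 (mul_le_mul h1 ?_ (abs_nonneg _) hδ0)
            calc |n₁ + 1| ≤ |n₁| + |1| := abs_add_le _ _
              _ ≤ (1 + δ) + 1 := by rw [abs_one]; linarith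
              _ = 2 + δ := by ring
        _ ≤ 4 * δ := by nlinarith only [hδ0, hδ1]
    have b2 : |n₇ - n₁ * n₃| ≤ 3 * δ := by
      calc |n₇ - n₁ * n₃| ≤ |n₇| + |n₁ * n₃| := abs_sub _ _
        _ = |n₇| + |n₁| * |n₃| := by rw [abs_mul]
        _ ≤ δ + (1 + δ) * δ := add_le_add h7 (mul_le_mul hn1 h3 (abs_nonneg _) (by linarith only [hδ0]))
        _ ≤ 3 * δ := by nlinarith only [hδ0, hδ1]
    have b3 : |n₆ - n₃ ^ 2| ≤ 2 * δ := by
      calc |n₆ - n₃ ^ 2| ≤ |n₆| + |n₃ ^ 2| := abs_sub _ _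
        _ = |n₆| + |n₃| ^ 2 := by rw [abs_pow]
        _ ≤ δ + δ ^ 2 := add_le_add h6 (pow_le_pow_left₀ (abs_nonneg _) h3 2)
        _ ≤ 2 * δ := by nlinarith only [hδ0, hδ1]
    have t1 : |φr ^ 2 * (n₅ - n₁ ^ 2)| ≤ φr ^ 2 * (4 * δ) := by
      rw [abs_mul, abs_of_nonneg (sq_nonneg _)]; exact mul_le_mul_of_nonneg_left b1 (sq_nonneg _)
    have t2 : |2 * (φr * φt) * (n₇ - n₁ * n₃)| ≤ 2 * |φr * φt| * (3 * δ) := by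
      rw [abs_mul, abs_mul, abs_of_pos (by norm_num : (0 : ℝ) < 2)]
      exact mul_le_mul_of_nonneg_left b2 (by positivity)
    have t3 : |φt ^ 2 * (n₆ - n₃ ^ 2)| ≤ φt ^ 2 * (2 * δ) := by
      rw [abs_mul, abs_of_nonneg (sq_nonneg _)]; exact mul_le_mul_of_nonneg_left b3 (sq_nonneg _)
    calc |φr ^ 2 * (n₅ - n₁ ^ 2) + 2 * (φr * φt) * (n₇ - n₁ * n₃) + φt ^ 2 * (n₆ - n₃ ^ 2)|
        ≤ |φr ^ 2 * (n₅ - n₁ ^ 2)| + |2 * (φr * φt) * (n₇ - n₁ * n₃)| + |φt ^ 2 * (n₆ - n₃ ^ 2)| :=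
          (abs_add_le _ _).trans (add_le_add (abs_add_le _ _) le_rfl)
      _ ≤ φr ^ 2 * (4 * δ) + 2 * |φr * φt| * (3 * δ) + φt ^ 2 * (2 * δ) := by linarith only [t1, t2, t3]
      _ ≤ 7 * δ * D₀ := by
          rw [hD₀]
          have : 2 * |φr * φt| * (3 * δ) ≤ (φr ^ 2 + φt ^ 2) * (3 * δ) :=
            mul_le_mul_of_nonneg_right (two_mul_abs_mul_le φr φt) (by positivity)
          have p1 : 0 ≤ δ * φt ^ 2 := by positivity
          linarith only [this, p1]
  -- (7) `|N - N₀|`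
  have hNN : |N - N₀| ≤ 6 * δ * D₀ * h + 7 * δ * D₀ * (|φr| / r) := by
    have e : N - N₀ = (A * (α ^ 2 - φr ^ 2) + B * (α * β - φr * φt) + C * (β ^ 2 - φt ^ 2)) +
        φr / r * (Lg - α ^ 2) := by rw [hN, hN₀]; ring
    rw [e]
    calc |A * (α ^ 2 - φr ^ 2) + B * (α * β - φr * φt) + C * (β ^ 2 - φt ^ 2) + φr / r * (Lg - α ^ 2)|
        ≤ |A * (α ^ 2 - φr ^ 2) + B * (α * β - φr * φt) + C * (β ^ 2 - φt ^ 2)| +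
            |φr / r * (Lg - α ^ 2)| := abs_add_le _ _
      _ ≤ 6 * δ * D₀ * h + |φr| / r * (7 * δ * D₀) := by
          refine add_le_add hHpart ?_
          rw [abs_mul, abs_div, abs_of_pos hr]
          exact mul_le_mul_of_nonneg_left hLpart (by positivity)
      _ = 6 * δ * D₀ * h + 7 * δ * D₀ * (|φr| / r) := by ring
  -- (8) `|N/D - N₀/D₀|`
  have hfrac : |N / D - N₀ / D₀| ≤ 16 * δ * h + 14 * δ * (|φr| / r) := by
    have e : N / D - N₀ / D₀ = (N - N₀) / D + N₀ * (D₀ - D) / (D * D₀) := by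
      field_simp
      ring
    rw [e]
    have t1 : |(N - N₀) / D| ≤ (6 * δ * D₀ * h + 7 * δ * D₀ * (|φr| / r)) / (D₀ / 2) := by
      rw [abs_div, abs_of_pos hDpos]
      exact div_le_div₀ (by positivity) hNN (by positivity) hDge
    have t2 : |N₀ * (D₀ - D) / (D * D₀)| ≤ (h * D₀) * (2 * δ * D₀) / (D₀ / 2 * D₀) := by
      rw [abs_div, abs_mul, abs_of_pos (mul_pos hDpos hD₀pos), abs_sub_comm]
      exact div_le_div₀ (by positivity) (mul_le_mul hN₀le hDD (abs_nonneg _) (by positivity))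
        (by positivity) (mul_le_mul_of_nonneg_right hDge hD₀pos.le)
    have e1 : (6 * δ * D₀ * h + 7 * δ * D₀ * (|φr| / r)) / (D₀ / 2) = 12 * δ * h + 14 * δ * (|φr| / r) := by
      field_simp
      ring
    have e2 : (h * D₀) * (2 * δ * D₀) / (D₀ / 2 * D₀) = 4 * δ * h := by
      field_simp
      ring
    calc |(N - N₀) / D + N₀ * (D₀ - D) / (D * D₀)|
        ≤ |(N - N₀) / D| + |N₀ * (D₀ - D) / (D * D₀)| := abs_add_le _ _
      _ ≤ 12 * δ * h + 14 * δ * (|φr| / r) + 4 * δ * h := by rw [← e1, ← e2]; exact add_le_add t1 t2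
      _ = 16 * δ * h + 14 * δ * (|φr| / r) := by ring
  -- (9) conclusion
  calc |(trM - trM₀) - (N / D - N₀ / D₀)| ≤ |trM - trM₀| + |N / D - N₀ / D₀| := abs_sub _ _
    _ ≤ δ * h + 2 * δ * |φr| / r + (16 * δ * h + 14 * δ * (|φr| / r)) := add_le_add htr hfrac
    _ ≤ 20 * δ * h + 20 * δ * |φr| / r := by
        have p1 : 0 ≤ δ * (|φr| / r) := by positivity
        have p2 : 0 ≤ δ * h := by positivity
        have e : 2 * δ * |φr| / r = 2 * (δ * (|φr| / r)) := by ring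
        have e' : 20 * δ * |φr| / r = 20 * (δ * (|φr| / r)) := by ring
        rw [e, e']
        linarith only [p1, p2]

end Scalar

end Literature.Geometry.Riemannian

end
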